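import Literature.NumberTheory.EllipticCurves.RingClassFieldGenusProofs
import HarnessLib

/-!
# Genus theory at the primes dividing the discriminant: `√q* ∈ K[1]` (the Hilbert class field)
# for an odd prime `q ∣ d_K` (Cox, *Primes of the form x² + ny²*, §6.A Thm. 6.1; Gauss)

Topic `NumberTheory/EllipticCurves` (ring class fields realised in `ℂ`: `ringClassField K ι n = K[n]`
of `HeegnerPointsOfConductor.lean`; `K[1]` is the Hilbert class field). Companion of
`RingClassFieldGenusProofs.lean`, which proves `√d ∈ K[f]` for `d ≡ 1 (mod 4)` with `|d| ∣ f` (the genus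
characters of the ORDER of conductor `f`) and `√d ∉ K[m]` at a prime `ℓ ∣ d`, `ℓ ∤ m d_K`. This file adds
the complementary clause of Gauss's genus theory for the MAXIMAL order: for an odd prime `q` dividing the
field discriminant `d_K`, the prime discriminant `q* = (−1)^{(q−1)/2} q` has its square root in the
Hilbert class field `K[1]` — the genus character `(q*/N·)` of `Cl(K)` is trivial on principal ideals
(`N(a) ≡ □ (mod q)` because `4N(x + yω) = (2x + ty)² − d_K y²` and `q ∣ d_K`), so by Bauer's theorem
(degree-one primes, as in the companion file) `K(√q*) ⊆ K[1]` (Cox Thm. 6.1: "the genus field of `K`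
is `K(√p₁*, …, √p_r*)`", the maximal unramified extension of `K` abelian over `ℚ`). Everything is
PROVED (theorems only; no definition, no named fact).

* `primeStar_emod_four` — `q* ≡ 1 (mod 4)` for an odd prime `q`.
* `isSquare_primeStar_zmod_absNorm_span_singleton_of_dvd_discr` — the arithmetic step: for `K`
  imaginary quadratic, `q ∣ d_K` an odd prime and a principal prime `(a)` of odd prime norm `ℓ ≠ q`:
  `q*` is a square modulo `ℓ` (`4ℓ = s² − d_K y² ≡ s² (mod q)`, `s ≢ 0`, and Jacobi reciprocity via the
  tree's `RingClass.isSquare_intCast_zmod_of_dvd_sub_sq`).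
* **`sqrt_primeStar_mem_ringClassField_one`** — `√q* ∈ K[1]`; and the case used by LINE B49 of cell
  `bsd-goldfeld` (`K = ℚ(√−q)`, `q ≡ 1 (mod 4)`, `d_K = −4q`): `sqrt_mem_ringClassField_one_of_discr_eq`
  — `√q ∈ K[1]`, whence the genus field `K(i) = K(√q) ⊆ K[1]`.

HONEST FRAMING (cell `bsd-goldfeld`, seat s1p-c3 gen 6): field theory only; the (R0) input of the
rationality half of the genus-point input `X049GenusPointOddMultiple` (the genus character of `Cl(K)`
cut out by `√q ∈ K[1]`, in the currency of `Uniform/U2/GenusCharacter.exists_monoidHom_cutout`); no claim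
about Heegner points or BSD.

## References
* D. A. Cox, *Primes of the form x² + ny²*, 2nd ed. (2013), §6.A Thm. 6.1, §1.C Lemma 1.14, §7.C
  Lemma 7.18, §9.A Thm. 9.2, §11.A Thm. 11.1. [Cox2013]
* J. Neukirch, *Algebraic Number Theory* (1999), VII (13.9)–(13.10) (Bauer). [NeukirchANT1999]
-/

noncomputable section

open NumberField IsDedekindDomain IsDedekindDomain.HeightOneSpectrum Filter Polynomial Module
open scoped nonZeroDivisors IntermediateField

namespace Literature.NumberTheory.EllipticCurves

open Literature.NumberTheory.GaloisRepresentations Literature.NumberTheory.NumberFields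
open Literature.NumberTheory.NumberFields.RingClassField
open Literature.NumberTheory.QuadraticFields.RingClass Literature.NumberTheory.QuadraticFields.Quadratic

variable {K : Type} [Field K] [NumberField K]

/-! ### The prime discriminant `q*` -/

/-- `q* = (−1)^{(q−1)/2}·q ≡ 1 (mod 4)` for an odd prime `q` (`q ≡ 1`: `q* = q`; `q ≡ 3`: `q* = −q`).
[cite: Cox2013, §1.C Lemma 1.14] -/
theorem primeStar_emod_four {q : ℕ} (hq : q.Prime) (hq2 : q ≠ 2) :
    ((-1 : ℤ) ^ (q / 2) * q) % 4 = 1 := by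
  rcases Nat.odd_mod_four_iff.mp (Nat.odd_iff.mp (hq.odd_of_ne_two hq2)) with h | h
  · have he : Even (q / 2) := ⟨q / 4, by omega⟩
    rw [he.neg_one_pow, one_mul]; omega
  · have ho : Odd (q / 2) := ⟨q / 4, by omega⟩
    rw [ho.neg_one_pow, neg_one_mul]; omega

/-- `|q*| = q`: an integer divisible by the prime `ℓ` and dividing `q*` forces `ℓ ∣ q`. [folklore] -/
private theorem natCast_dvd_of_dvd_primeStar {q ℓ : ℕ} (h : (ℓ : ℤ) ∣ (-1 : ℤ) ^ (q / 2) * q) : ℓ ∣ q := by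
  have h' : (ℓ : ℤ) ∣ (q : ℤ) := by
    have hu : IsUnit ((-1 : ℤ) ^ (q / 2)) := (isUnit_neg_one (α := ℤ)).pow _
    exact (hu.dvd_mul_left).mp h
  exact_mod_cast h'

/-! ### The arithmetic step: `(q*/N(a)) = 1` for a principal prime `(a)` -/

/-- **The genus character `(q*/N·)`, `q ∣ d_K`, is trivial on principal primes.** Let `K` be
imaginary quadratic (`[K:ℚ] = 2`, `d_K < 0`), `q` an odd prime dividing `d_K`, and `a ∈ 𝓞_K` with
`N((a)) = ℓ` an odd prime `≠ q`. Then `q*` is a square modulo `ℓ`: on an integral basis `(1, ω)`,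
`ω² = m + tω`, `d_K = t² + 4m`, one has `4ℓ = 4N(x + yω) = (2x + ty)² − d_K y² ≡ (2x + ty)² (mod q)`
with `q ∤ 2x + ty` (else `q ∣ ℓ`), so `ℓ ≡ n² (mod q)` with `q ∤ n` and `(q*/ℓ) = 1` by Jacobi
reciprocity (`RingClass.isSquare_intCast_zmod_of_dvd_sub_sq`). [cite: Cox2013, §6.A Thm. 6.1 and §1.C Lemma 1.14] -/
theorem isSquare_primeStar_zmod_absNorm_span_singleton_of_dvd_discr (h2 : finrank ℚ K = 2)
    (hneg : NumberField.discr K < 0) {q : ℕ} (hq : q.Prime) (hq2 : q ≠ 2)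
    (hqD : (q : ℤ) ∣ NumberField.discr K) (a : 𝓞 K) {ℓ : ℕ} (hℓ : ℓ.Prime) (hℓ2 : ℓ ≠ 2)
    (hℓq : ℓ ≠ q) (hN : Ideal.absNorm (Ideal.span {a}) = ℓ) :
    IsSquare ((((-1 : ℤ) ^ (q / 2) * q : ℤ) : ZMod ℓ)) := by
  obtain ⟨b, hb⟩ := exists_basis_zero_eq_one (K := K) h2
  set m : ℤ := b.repr (b 1 * b 1) 0 with hm
  set t : ℤ := b.repr (b 1 * b 1) 1 with ht
  have hω : b 1 * b 1 = (m : 𝓞 K) + (t : 𝓞 K) * b 1 := basis_one_mul_self_eq b hb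
  have hD : NumberField.discr K = t ^ 2 + 4 * m := discr_eq_sq_add_four_mul b hb
  set x : ℤ := b.repr a 0 with hx
  set y : ℤ := b.repr a 1 with hy
  have ha : a = (x : 𝓞 K) + (y : 𝓞 K) * b 1 := eq_repr_add_repr_mul_of_basis b hb a
  have hnorm : Algebra.norm ℤ a = x ^ 2 + t * x * y - m * y ^ 2 := by
    rw [ha]; exact norm_intCast_add_intCast_mul b hb hω x y
  have hnn : 0 ≤ Algebra.norm ℤ a := by
    rw [hnorm]; exact normForm_nonneg (by rw [← hD]; exact hneg) x y
  have hℓeq : (ℓ : ℤ) = x ^ 2 + t * x * y - m * y ^ 2 := by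
    rw [← hnorm, ← hN, Ideal.absNorm_span_singleton, Int.natCast_natAbs, abs_of_nonneg hnn]
  -- `4ℓ = s² − d_K y²`, `s = 2x + ty`
  set s : ℤ := 2 * x + t * y with hs
  have h4 : 4 * (ℓ : ℤ) = s ^ 2 - NumberField.discr K * y ^ 2 := by rw [hℓeq, hD, hs]; ring
  have hqs2 : (q : ℤ) ∣ 4 * (ℓ : ℤ) - s ^ 2 := by
    rw [h4]; exact ⟨-(NumberField.discr K / q) * y ^ 2, by
      rw [show -(NumberField.discr K / (q : ℤ)) * y ^ 2 = -(NumberField.discr K / q * y ^ 2) by ring,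
        mul_neg, ← mul_assoc, Int.mul_ediv_cancel' hqD]; ring⟩
  -- `q ∤ s`
  have hqp : Prime (q : ℤ) := Nat.prime_iff_prime_int.mp hq
  have hqs : ¬ (q : ℤ) ∣ s := by
    intro hdiv
    have h4ℓ : (q : ℤ) ∣ 4 * (ℓ : ℤ) := by
      have := dvd_add hqs2 (dvd_pow hdiv two_ne_zero)
      rwa [sub_add_cancel] at this
    rcases hqp.dvd_or_dvd h4ℓ with h4' | hℓ'
    · have h4q : q ∣ 2 ^ 2 := by exact_mod_cast h4'
      exact hq2 ((Nat.prime_dvd_prime_iff_eq hq Nat.prime_two).mp (hq.dvd_of_dvd_pow h4q))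
    · have : q ∣ ℓ := by exact_mod_cast hℓ'
      exact hℓq ((Nat.prime_dvd_prime_iff_eq hq hℓ).mp this).symm
  -- `n = s · (q+1)/2`, `(q+1)/2` an inverse of `2` modulo `q`
  set u : ℤ := ((q : ℤ) + 1) / 2 with hu
  have hu2 : 2 * u = q + 1 := by
    obtain ⟨k, hk⟩ := hq.odd_of_ne_two hq2
    rw [hu]; omega
  set n : ℤ := s * u with hn
  obtain ⟨c, hc⟩ := hqs2
  have hmodq : (q : ℤ) ∣ (ℓ : ℤ) - n ^ 2 :=
    ⟨-(ℓ : ℤ) * (q + 2) + c * u ^ 2, by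
      rw [hn]; linear_combination u ^ 2 * hc - (ℓ : ℤ) * (2 * u + q + 1) * hu2⟩
  have hmod : ((-1 : ℤ) ^ (q / 2) * q) ∣ (ℓ : ℤ) - n ^ 2 :=
    (((isUnit_neg_one (α := ℤ)).pow _).mul_left_dvd).mpr hmodq
  -- `q ∤ n`
  have hqu : ¬ (q : ℤ) ∣ u := by
    rintro ⟨k, hk⟩
    have h1 : (q : ℤ) ∣ 1 := ⟨2 * k - 1, by linear_combination -hu2 + 2 * hk⟩
    exact hq.one_lt.ne' (by exact_mod_cast Int.eq_one_of_dvd_one (by positivity) h1)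
  have hqn : ¬ (q : ℤ) ∣ n := fun h => (hqp.dvd_or_dvd h).elim hqs hqu
  have hgcd : Int.gcd n ((-1 : ℤ) ^ (q / 2) * q) = 1 := by
    have hg : Int.gcd n q = 1 :=
      Int.isCoprime_iff_gcd_eq_one.mp ((hqp.coprime_iff_not_dvd.mpr hqn).symm)
    rcases neg_one_pow_eq_or ℤ (q / 2) with h | h
    · rw [h, one_mul]; exact hg
    · rw [h, neg_one_mul, Int.gcd_neg]; exact hg
  exact isSquare_intCast_zmod_of_dvd_sub_sq (primeStar_emod_four hq hq2) hℓ hℓ2 hgcd hmod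

/-! ### The quadratic subextension `K(√d) ⊆ K̄` (as in the companion file, where it is private) -/

omit [NumberField K] in
/-- `K(√d) ⊆ K̄` is a quadratic Galois extension of `K` when `d` is not a square in `K`, with a root
`s ∉ K` (the companion file's private lemma, re-proved). [folklore] -/
private theorem exists_quadratic_intermediateField_of_not_isSquare' [CharZero K] {d : K}
    (hd : ¬ IsSquare d) :
    ∃ (Q : IntermediateField K (AlgebraicClosure K)) (s : Q), FiniteDimensional K Q ∧
      Algebra.IsQuadraticExtension K Q ∧ IsGalois K Q ∧
      s ^ 2 = algebraMap K Q d ∧ ∀ r : K, algebraMap K Q r ≠ s := by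
  obtain ⟨s₀, hs₀⟩ := IsAlgClosed.exists_pow_nat_eq (algebraMap K (AlgebraicClosure K) d) two_pos
  have hirr : Irreducible (X ^ 2 - C d : K[X]) := by
    refine X_pow_sub_C_irreducible_of_prime Nat.prime_two fun b hb => hd ⟨b, ?_⟩
    rw [← hb]; ring
  have hint : IsIntegral K s₀ := Algebra.IsIntegral.isIntegral s₀
  have hmin : minpoly K s₀ = X ^ 2 - C d := by
    refine (minpoly.eq_of_irreducible_of_monic hirr ?_ (monic_X_pow_sub_C d two_ne_zero)).symm
    simp [hs₀]
  set Q : IntermediateField K (AlgebraicClosure K) := K⟮s₀⟯ with hQ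
  have h2 : Module.finrank K Q = 2 := by
    rw [hQ, IntermediateField.adjoin.finrank hint, hmin, natDegree_X_pow_sub_C]
  haveI hfd : FiniteDimensional K Q := Module.finite_of_finrank_eq_succ h2
  haveI hquad : Algebra.IsQuadraticExtension K Q := { finrank_eq_two' := h2 }
  haveI : IsGalois K Q := inferInstance
  refine ⟨Q, ⟨s₀, IntermediateField.mem_adjoin_simple_self K s₀⟩, hfd, hquad, inferInstance, ?_, ?_⟩
  · apply Subtype.ext
    rw [SubmonoidClass.mk_pow, IntermediateField.coe_algebraMap_apply]
    exact hs₀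
  · intro r hr
    apply hd
    refine ⟨r, ?_⟩
    have h0 : algebraMap K (AlgebraicClosure K) r = s₀ := by
      have := congrArg (fun x : Q => (x : AlgebraicClosure K)) hr
      rwa [IntermediateField.coe_algebraMap_apply] at this
    have h2' : algebraMap K (AlgebraicClosure K) (r ^ 2) = algebraMap K (AlgebraicClosure K) d := by
      rw [map_pow, h0]; exact hs₀
    have := (algebraMap K (AlgebraicClosure K)).injective h2'
    rw [← this]; ring

/-! ### `√q* ∈ K[1]` for an odd prime `q ∣ d_K` -/

/-- **Genus theory of the Hilbert class field: `√q* ∈ K[1]` for an odd prime `q ∣ d_K`.** Let `K` be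
imaginary quadratic, `ι : K → ℂ`, `q` an odd prime dividing `d_K`. Then every complex square root of
`q* = (−1)^{(q−1)/2} q` lies in `K[1] = ringClassField K ι 1`, the Hilbert class field (Cox Thm. 6.1:
`K(√q*)` is contained in the genus field `⊆` the Hilbert class field; proof by Bauer's theorem on
degree-one primes and `isSquare_primeStar_zmod_absNorm_span_singleton_of_dvd_discr`, exactly as the
companion file's `sqrt_intCast_mem_ringClassField`). [cite: Cox2013, §6.A Thm. 6.1 and §11.A Thm. 11.1] -/
theorem sqrt_primeStar_mem_ringClassField_one (hK : IsImaginaryQuadratic K) (ι : K →+* ℂ) {q : ℕ}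
    (hq : q.Prime) (hq2 : q ≠ 2) (hqD : (q : ℤ) ∣ NumberField.discr K) (r : ℂ)
    (hr : r ^ 2 = ((((-1 : ℤ) ^ (q / 2) * q : ℤ)) : ℂ)) : r ∈ ringClassField K ι 1 := by
  classical
  set d : ℤ := (-1 : ℤ) ^ (q / 2) * q with hd
  suffices hz : ∃ z : ℂ, z ∈ ringClassField K ι 1 ∧ z ^ 2 = (d : ℂ) by
    obtain ⟨z, hz, hz2⟩ := hz
    rcases sq_eq_sq_iff_eq_or_eq_neg.mp (hr.trans hz2.symm) with h | h
    · rw [h]; exact hz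
    · rw [h]; exact neg_mem hz
  by_cases hsqK : IsSquare (d : K)
  · obtain ⟨k, hk⟩ := hsqK
    refine ⟨ι k, apply_mem_ringClassField ι 1 k, ?_⟩
    rw [sq, ← map_mul, ← hk, map_intCast]
  obtain ⟨Q, s, hfdQ, hquad, hgalQ, hs2, hsK⟩ :=
    exists_quadratic_intermediateField_of_not_isSquare' (K := K) hsqK
  haveI := hfdQ
  haveI := hquad
  haveI := hgalQ
  haveI : NumberField Q := NumberField.of_module_finite K Q
  obtain ⟨R, hfd, hgal, -, hsplit, ⟨e⟩⟩ := exists_classField_algEquiv_ringClassField hK ι one_ne_zero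
  haveI := hfd
  haveI := hgal
  have hQR : Q ≤ R := by
    refine le_of_splitPrimes_subset_of_prime_absNorm_algClosure ?_
    have h𝔪 : Ideal.span {((2 * q : ℕ) : 𝓞 K)} ≠ ⊥ := by
      rw [Ne, Ideal.span_singleton_eq_bot]; exact_mod_cast (mul_ne_zero two_ne_zero hq.ne_zero)
    have hev : ∀ᶠ v : HeightOneSpectrum (𝓞 K) in cofinite,
        ¬ Ideal.span {((2 * q : ℕ) : 𝓞 K)} ≤ v.asIdeal := by
      rw [Filter.eventually_cofinite]
      simpa using finite_setOf_le_asIdeal h𝔪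
    refine hev.mono fun v hv hprime hvR => ?_
    set ℓ : ℕ := Ideal.absNorm v.asIdeal with hℓdef
    have hℓv : ((ℓ : ℕ) : 𝓞 K) ∈ v.asIdeal := Ideal.absNorm_mem v.asIdeal
    have hmem_of_dvd : ∀ n : ℕ, n ∣ 2 * q → ((n : ℕ) : 𝓞 K) ∈ v.asIdeal →
        Ideal.span {((2 * q : ℕ) : 𝓞 K)} ≤ v.asIdeal := fun n hn hnv => by
      rw [Ideal.span_singleton_le_iff_mem]
      obtain ⟨k, hk⟩ := hn
      rw [hk, Nat.cast_mul]
      exact Ideal.mul_mem_right _ _ hnv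
    have hv1 : ¬ Ideal.span {((1 : ℕ) : 𝓞 K)} ≤ v.asIdeal := fun hle => by
      rw [Nat.cast_one, Ideal.span_singleton_one, top_le_iff] at hle
      exact v.isPrime.ne_top hle
    have hℓ2 : ℓ ≠ 2 := fun h2 => hv (hmem_of_dvd 2 (dvd_mul_right 2 q) (h2 ▸ hℓv))
    have hℓq : ℓ ≠ q := fun h2 => hv (hmem_of_dvd q (dvd_mul_left q 2) (h2 ▸ hℓv))
    have hℓd : ¬ (ℓ : ℤ) ∣ d := fun hℓd =>
      hℓq ((Nat.prime_dvd_prime_iff_eq hprime hq).mp (natCast_dvd_of_dvd_primeStar hℓd))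
    -- `[𝔭_v] = 1`: `v = (a)`, so `q*` is a square mod `ℓ = N v`, so `v` splits in `Q`
    have h1 : primeClass 1 v = 1 := (hsplit v hv1).mp hvR
    obtain ⟨a, -, -, hva, -⟩ := exists_generator_of_primeClass_eq_one 1 hv1 h1
    have hsq : IsSquare ((d : ZMod ℓ)) :=
      isSquare_primeStar_zmod_absNorm_span_singleton_of_dvd_discr hK.1 hK.discr_neg hq hq2 hqD a
        hprime hℓ2 hℓq (by rw [← hva])
    exact NumberFields.QuadraticExtension.mem_splitPrimes_of_isSquare_zmod hs2 hsK v hprime hℓ2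
      rfl hℓd hsq
  -- transport `s ∈ Q ≤ R ≅ K[1] ⊂ ℂ`
  set sR : R := ⟨(s : AlgebraicClosure K), hQR s.2⟩ with hsR
  have hsR2 : sR ^ 2 = algebraMap K R d := by
    apply Subtype.ext
    have h := congrArg (fun x : Q => (x : AlgebraicClosure K)) hs2
    rw [SubmonoidClass.coe_pow, IntermediateField.coe_algebraMap_apply] at h
    rw [SubmonoidClass.coe_pow, IntermediateField.coe_algebraMap_apply]
    exact h
  refine ⟨((e sR : ringClassField K ι 1) : ℂ), (e sR).2, ?_⟩
  have h3 : (e sR) ^ 2 = algebraMap K (ringClassField K ι 1) d := by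
    rw [← map_pow, hsR2, AlgEquiv.commutes]
  have h4 := congrArg (fun x : ringClassField K ι 1 => (x : ℂ)) h3
  simp only [SubmonoidClass.coe_pow, map_intCast] at h4
  rw [h4]
  simp

/-- **The case of LINE B49: `√q ∈ K[1]` for `K` imaginary quadratic with `d_K = −4q`, `q ≡ 1 (mod 4)`
prime** (`q* = q`). Hence the genus field `K(√q) = K(i)` of `K = ℚ(√−q)` lies in the Hilbert class
field `K[1]`, and the genus character of `Cl(K) ≅ Gal(K[1]/K)` is the character cut out by `√q`.
[cite: Cox2013, §6.A Thm. 6.1] -/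
theorem sqrt_mem_ringClassField_one_of_discr_eq (hK : IsImaginaryQuadratic K) (ι : K →+* ℂ) {q : ℕ}
    (hq : q.Prime) (hq4 : q % 4 = 1) (hdK : NumberField.discr K = -(4 * (q : ℤ))) (r : ℂ)
    (hr : r ^ 2 = (q : ℂ)) : r ∈ ringClassField K ι 1 := by
  have hq2 : q ≠ 2 := by rintro rfl; norm_num at hq4
  have he : Even (q / 2) := ⟨q / 4, by omega⟩
  refine sqrt_primeStar_mem_ringClassField_one hK ι hq hq2 ⟨-4, by rw [hdK]; ring⟩ r ?_
  rw [he.neg_one_pow, one_mul]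
  exact_mod_cast hr

end Literature.NumberTheory.EllipticCurves

end
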